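import Summits.BirchSwinnertonDyer.BirchSwinnertonDyer.Theorems.AdditiveKolyvaginRoadLocalPackageOfKolyvaginPrime
import Summits.BirchSwinnertonDyer.BirchSwinnertonDyer.Theorems.AdditiveKolyvaginRoadKolyvaginTransverseIsotropy
import Summits.BirchSwinnertonDyer.BirchSwinnertonDyer.Theorems.AdditiveKolyvaginRoadKolyvaginLine
import HarnessLib

/-!
# Route `AdditiveKolyvaginRoad`, crux `KolyvaginPrimitiveAdditive` (item stmt-BirchSwinnertonDyer-20132):
# stub LOC REDUCED TO (Perf) + (Supply) at a general odd prime `p` — the state of the local–global package after the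
# kernel inputs, (Tr-iso) and (Line)
# (cell `pub/bsd-wall`, lead prover `bsd-wall-akr-p1` g3; `--supports stmt-BirchSwinnertonDyer-20132`, helper)

WHY THIS FILE. One theorem recording WHAT IS LEFT of stub LOC `stub_kolyvaginLocalPackageAdditive` of skeleton v7.1/v8
of crux 20132 after this seat's reductions: `Nonempty (KolyvaginLocalPackageP W K p ι c)` at a ♯-type frame (`K`
imaginary quadratic, `p` odd, `ρ̄_{E,p}` onto, `c ≠ 1`) follows from EXACTLY TWO inputs —
* (Perf) `hperf`: at every Kolyvagin prime `λ`, for every Weil pairing `e` on `E[p]`, a Kummer `s`-eigenclass non-zero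
  at `λ` and a transverse `s`-eigenclass non-zero at `λ` have non-zero local Weil cup product [W. Zhang Lemma 8.4
  (1)/(3) with Gross Prop. 8.1–8.2; `p = 3`: zhang3-p1 `…Method2KolyvaginPerf{,Core,Local,Cocycles}` +
  `…CupNonvanishing`, ≈ 1 400 lines, to be ported `3 ↦ p`];
* (Supply) `hSupply`: W. Zhang's Lemma 8.2 for the level-`n` structure [E-side Poitou–Tate Euler characteristic;
  `p = 3`: `…ZhangSupply*`, in progress in cell bsd-stepL] —
everything else being tree theorems: `b = inv ∘ ∪ₑ`, (REC), Kummer and TORIC isotropy (p533303), (Tr-iso) (p535599),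
(Line) (`…KolyvaginLine`, through the Zhang ⟹ Gross bridge `…KolyvaginGrossBridge`).

HONEST FRAMING: one theorem; 0 definitions, 0 named facts, 0 `sorry`; CONDITIONAL on (Perf) and (Supply); does NOT
close stub LOC.

References: [cite: WZhang2014, §8.1, Lemma 8.1, Lemma 8.2, Lemma 8.4] [cite: GrossLMS1991, Prop. 8.1, Prop. 8.2,
Prop. 9.6] [cite: MilneADT2006, Ch. I, Thm. 4.10].
-/

-- single-conjunct summit: `Summit.BirchSwinnertonDyer.BirchSwinnertonDyer.…` repeats the name by design
set_option linter.dupNamespace false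

noncomputable section

open scoped Classical

namespace Summit.BirchSwinnertonDyer.BirchSwinnertonDyer.Theorems.AdditiveKoly

open CategoryTheory WeierstrassCurve NumberField IsDedekindDomain Field
  Literature.NumberTheory.EllipticCurves Literature.NumberTheory.EllipticCurves.ModularForms
  Literature.NumberTheory.GaloisRepresentations Module
open Literature.NumberTheory.GaloisCohomology
open scoped ContRepresentation

variable (W : WeierstrassCurve ℚ) (K : Type) [Field K] [NumberField K] (p : ℕ)
variable [W.IsElliptic] [W.IsGloballyMinimal] [Fact p.Prime] (ι : K →+* ℂ) (c : K ≃ₐ[ℚ] K)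
  [∀ v : Place K, Module (ZMod p)
    (galoisCohomology (((W.baseChange K).torsionGaloisModule ((p ^ 1 : ℕ) : ℤ)).toLocal v) 1)]
  [∀ v : Place K, CompactSpace (absoluteGaloisGroup (Place.Completion v))]
  [Finite (geomTorsion (W.baseChange K) ((p ^ 1 : ℕ) : ℤ))]

/-- **Stub LOC of crux 20132 from (Perf) + (Supply) alone**, at a ♯-type frame (`K` imaginary quadratic, `p` odd,
`ρ̄_{E,p}` onto, `c ≠ 1`): `kolyvaginLocalPackageP_of_kolyvaginPrimePackage` fed with the kernel theorems (Tr-iso)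
`cupProduct_eq_zero_of_mem_transverseLocalKerP` and (Line) `exists_kummerEigenLine_P`. What remains: (Perf) at Kolyvagin
primes (for every Weil pairing) and (Supply) = W. Zhang's Lemma 8.2. [cite: WZhang2014, §8.1, Lemma 8.2, Lemma 8.4]
[cite: GrossLMS1991, Prop. 8.1, Prop. 9.6] -/
theorem kolyvaginLocalPackageP_of_perf_of_supply (hK : IsImaginaryQuadratic K) (hp2 : p ≠ 2)
    (hsurj : W.HasSurjectiveModNGaloisRep p) (hc : c ≠ 1)
    -- (Perf): Kummer^s × transverse^s is non-degenerate at Kolyvagin primes, for every Weil pairing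
    (hperf : ∀ (e : geomTorsion (W.baseChange K) ((p ^ 1 : ℕ) : ℤ) → geomTorsion (W.baseChange K) ((p ^ 1 : ℕ) : ℤ) →
        AlgebraicClosure K)
      (hμ : ∀ P Q, e P Q ^ (p ^ 1) = 1) (hadd₁ : ∀ P₁ P₂ Q, e (P₁ + P₂) Q = e P₁ Q * e P₂ Q)
      (hadd₂ : ∀ P Q₁ Q₂, e P (Q₁ + Q₂) = e P Q₁ * e P Q₂) (_halt : ∀ Q, e Q Q = 1)
      (_hnondeg : ∀ Q, (∀ P, e P Q = 1) → Q = 0)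
      (hgal : ∀ (σ : absoluteGaloisGroup K) (P Q : geomTorsion (W.baseChange K) ((p ^ 1 : ℕ) : ℤ)),
        σ • e P Q = e (σ • P) (σ • Q))
      (ℓ : ℕ), Zhang2014.IsKolyvaginPrime (W.conductorNorm ℤ) W K p ℓ →
      ∀ (v : HeightOneSpectrum (𝓞 K)), ((ℓ : ℕ) : 𝓞 K) ∈ v.asIdeal → ∀ (s : Bool) (x y : Vp W K p),
      conjAct W c ((p ^ 1 : ℕ) : ℤ) x = sgnP s • x → conjAct W c ((p ^ 1 : ℕ) : ℤ) y = sgnP s • y →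
      x ∈ selmerLocalKer (W.baseChange K) (v.adicCompletion K) ((p ^ 1 : ℕ) : ℤ) →
      x ∉ (W.baseChange K).torsionLocalKer (v.adicCompletion K) ((p ^ 1 : ℕ) : ℤ) →
      y ∈ transverseLocalKerP W K p ι ℓ v →
      y ∉ (W.baseChange K).torsionLocalKer (v.adicCompletion K) ((p ^ 1 : ℕ) : ℤ) →
      (weilContPairingLocal (W.baseChange K) (p ^ 1) e hμ hadd₁ hadd₂ hgal (Sum.inr v)).cupProduct
        (galoisCohomology.localization ((W.baseChange K).torsionGaloisModule ((p ^ 1 : ℕ) : ℤ)) (Sum.inr v) 1 x)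
        (galoisCohomology.localization ((W.baseChange K).torsionGaloisModule ((p ^ 1 : ℕ) : ℤ)) (Sum.inr v) 1 y)
          ≠ 0)
    -- (Supply): Zhang's Lemma 8.2 for the level-n structure (verbatim the field `supply`)
    (hSupply : ∀ (n : Finset (AdmQ W K p)), n.Nonempty →
      ∀ (ℓ : {ℓ // Zhang2014.IsKolyvaginPrime (W.conductorNorm ℤ) W K p ℓ})
        (T : Finset {ℓ // Zhang2014.IsKolyvaginPrime (W.conductorNorm ℤ) W K p ℓ}), ℓ ∉ T →
      ∀ s : Bool, ∃ x : Vp W K p, conjAct W c ((p ^ 1 : ℕ) : ℤ) x = sgnP s • x ∧ x ≠ 0 ∧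
        (∀ w : InfinitePlace K, x ∈ selmerLocalKer (W.baseChange K) w.Completion ((p ^ 1 : ℕ) : ℤ)) ∧
        (∀ v : HeightOneSpectrum (𝓞 K), ((ℓ : ℕ) : 𝓞 K) ∉ v.asIdeal →
          (∀ ℓ' ∈ T, ((ℓ' : ℕ) : 𝓞 K) ∉ v.asIdeal) →
          ((∀ q ∈ n, ((q : ℕ) : 𝓞 K) ∉ v.asIdeal) →
            x ∈ selmerLocalKer (W.baseChange K) (v.adicCompletion K) ((p ^ 1 : ℕ) : ℤ)) ∧
          (∀ q ∈ n, ((q : ℕ) : 𝓞 K) ∈ v.asIdeal →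
            x ∈ toricLocalKer (W.baseChange K) (v.adicCompletion K) ((p ^ 1 : ℕ) : ℤ))) ∧
        (∀ ℓ' ∈ T, ∀ v : HeightOneSpectrum (𝓞 K), ((ℓ' : ℕ) : 𝓞 K) ∈ v.asIdeal →
          x ∈ transverseLocalKerP W K p ι ℓ' v)) :
    Nonempty (KolyvaginLocalPackageP W K p ι c) :=
  kolyvaginLocalPackageP_of_kolyvaginPrimePackage W K p ι c hK
    (cupProduct_eq_zero_of_mem_transverseLocalKerP W K p hK ι hp2) hperf
    (exists_kummerEigenLine_P W K p hK hp2 hsurj c hc) hSupply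

end Summit.BirchSwinnertonDyer.BirchSwinnertonDyer.Theorems.AdditiveKoly

end
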